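import Literature.Probability.Percolation.CornerPercolation
import Literature.Probability.Percolation.DiagonalBoxCrossing
import Literature.Probability.LatticeModels.ProdBernoulliIndependence
import HarnessLib

/-!
# Laminated corner configurations: unimodal paths and the orbit reduction
(negative-side support for crux `UniformBoxCrossing`, stmt-CriticalPhenomena-5476, route
`CardySelfDualSegment`; cdisprove seat, cycle 1; part 1 of 2, continued in `FalseWithoutFKG`)

At the endpoint `s = 1` of the extended corner family (splitting bit a.s. present) the corner map
sends the coins `c ⊆ ℤ²` to the LAMINATED configuration `lamConfig c`: every vertex `v` opens
exactly one of its east / north edges, the east one iff `v ∈ c` (`lamStep`, `lamOrbit`).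

* `path_unimodal` — every vertex has exactly one "upper" neighbour (`x + y` rises by one along
  `lamStep`), so a simple open path (inside any vertex set `T`) ascends along the forward orbit of
  its start and then descends along the reversed orbit of its end: no valleys.
* `lam_openCrossing_orbit`, `lam_crossing_orbit` — hence a horizontal crossing of
  `w + [0, 8n] × [0, n]` on `√2 ℤ²` (slack-2 event `embRectCrossing`) forces the forward orbit of a
  vertex `x` of the `2 × (n+1)` start box `startBox w n` to make at most `n` north steps among its
  first `5n` steps (`8n/√2 ≥ 5n` east steps are needed while the strip allows `≤ n/√2 ≤ n` north
  steps).

Plus two bookkeeping lemmas on `prodBernoulli` cylinders used in part 2. Elementary; [folklore]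
(coalescing north-east staircases: the "river network" endpoint, cf. crux NOTES-ideator1-r1 §1).
-/

namespace Summit.CriticalPhenomena.CardyFormulaZ2.Theorems.UniformBoxCrossing.Negative

open MeasureTheory Filter Literature.Probability.Percolation Literature.Probability.LatticeModels
open scoped Topology

noncomputable section

/-! ### The laminated configuration of a coin assignment -/

open Classical in
/-- One lamination step: from `v` go east if the coin of `v` is heads, north otherwise. -/
def lamStep (c : Set (Site 2)) (v : Site 2) : Site 2 :=
  if v ∈ c then v + ![1, 0] else v + ![0, 1]

/-- The forward orbit of `x` under `lamStep c`. -/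
def lamOrbit (c : Set (Site 2)) (x : Site 2) : ℕ → Site 2
  | 0 => x
  | j + 1 => lamStep c (lamOrbit c x j)

/-- The laminated bond configuration: every vertex opens exactly one of its east/north edges,
the east one iff its coin is heads. -/
def lamConfig (c : Set (Site 2)) : BondConfig (Site 2) :=
  {e | ∃ v : Site 2, (e = s(v, v + ![1, 0]) ∧ v ∈ c) ∨ (e = s(v, v + ![0, 1]) ∧ v ∉ c)}

/-- The orbit starts at `x`. -/
@[simp] theorem lamOrbit_zero (c : Set (Site 2)) (x : Site 2) : lamOrbit c x 0 = x := rfl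

/-- One more orbit step. -/
@[simp] theorem lamOrbit_succ (c : Set (Site 2)) (x : Site 2) (j : ℕ) :
    lamOrbit c x (j + 1) = lamStep c (lamOrbit c x j) := rfl

/-- The orbit after one step is the orbit of `lamStep c x`. -/
theorem lamOrbit_succ' (c : Set (Site 2)) (x : Site 2) (j : ℕ) :
    lamOrbit c x (j + 1) = lamOrbit c (lamStep c x) j := by
  induction j with
  | zero => rfl
  | succ j ih => rw [lamOrbit_succ, ih, lamOrbit_succ]

/-- Orbit times add. -/
theorem lamOrbit_add (c : Set (Site 2)) (x : Site 2) (i j : ℕ) :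
    lamOrbit c x (i + j) = lamOrbit c (lamOrbit c x i) j := by
  induction j with
  | zero => rfl
  | succ j ih => rw [← Nat.add_assoc, lamOrbit_succ, ih, lamOrbit_succ]

/-- When all splitting bits are present, the corner configuration is the laminated configuration
of the coins. -/
theorem cornerConfig_eq_lamConfig {S : Set (Site 2 × Fin 2)} (hS : ∀ v, (v, (1 : Fin 2)) ∈ S) :
    cornerConfig S = lamConfig {v | (v, (0 : Fin 2)) ∈ S} := by
  ext e
  simp only [mem_cornerConfig_iff, lamConfig, Set.mem_setOf_eq]
  constructor
  · rintro ⟨v, h | h⟩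
    · exact ⟨v, Or.inl h⟩
    · exact ⟨v, Or.inr ⟨h.1, fun hv => h.2.1 hv (hS v)⟩⟩
  · rintro ⟨v, h | h⟩
    · exact ⟨v, Or.inl h⟩
    · exact ⟨v, Or.inr ⟨h.1, ⟨fun hv => absurd hv h.2, fun _ => by
        exact absurd (hS v) ‹_›⟩⟩⟩

open Classical in
/-- The step vector coordinates. -/
theorem lamStep_apply_zero (c : Set (Site 2)) (v : Site 2) :
    lamStep c v 0 = v 0 + (if v ∈ c then 1 else 0) := by
  unfold lamStep; split_ifs <;> simp

open Classical in
/-- Ordinate of a lamination step. -/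
theorem lamStep_apply_one (c : Set (Site 2)) (v : Site 2) :
    lamStep c v 1 = v 1 + (if v ∈ c then 0 else 1) := by
  unfold lamStep; split_ifs <;> simp

/-- A lamination step raises `x + y` by one. -/
theorem lamStep_sum (c : Set (Site 2)) (v : Site 2) :
    lamStep c v 0 + lamStep c v 1 = v 0 + v 1 + 1 := by
  rw [lamStep_apply_zero, lamStep_apply_one]; split_ifs <;> ring

/-- Lamination steps do not decrease the abscissa. -/
theorem le_lamStep_zero (c : Set (Site 2)) (v : Site 2) : v 0 ≤ lamStep c v 0 := by
  rw [lamStep_apply_zero]; split_ifs <;> simp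

/-- Lamination steps do not decrease the ordinate. -/
theorem le_lamStep_one (c : Set (Site 2)) (v : Site 2) : v 1 ≤ lamStep c v 1 := by
  rw [lamStep_apply_one]; split_ifs <;> simp

/-- A lamination step moves. -/
theorem lamStep_ne_self (c : Set (Site 2)) (v : Site 2) : lamStep c v ≠ v := by
  intro h
  have := lamStep_sum c v
  rw [h] at this
  omega

/-- After `j` orbit steps `x + y` has risen by `j`. -/
theorem lamOrbit_sum (c : Set (Site 2)) (x : Site 2) (j : ℕ) :
    lamOrbit c x j 0 + lamOrbit c x j 1 = x 0 + x 1 + j := by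
  induction j with
  | zero => simp
  | succ j ih => rw [lamOrbit_succ, lamStep_sum, ih]; push_cast; ring

/-- Orbits do not decrease the abscissa. -/
theorem le_lamOrbit_zero (c : Set (Site 2)) (x : Site 2) (j : ℕ) : x 0 ≤ lamOrbit c x j 0 := by
  induction j with
  | zero => simp
  | succ j ih => exact ih.trans (le_lamStep_zero c _)

/-- Orbits do not decrease the ordinate. -/
theorem le_lamOrbit_one (c : Set (Site 2)) (x : Site 2) (j : ℕ) : x 1 ≤ lamOrbit c x j 1 := by
  induction j with
  | zero => simp
  | succ j ih => exact ih.trans (le_lamStep_one c _)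

/-- The ordinate is monotone along an orbit. -/
theorem lamOrbit_one_mono (c : Set (Site 2)) (x : Site 2) {i j : ℕ} (h : i ≤ j) :
    lamOrbit c x i 1 ≤ lamOrbit c x j 1 := by
  obtain ⟨k, rfl⟩ := Nat.exists_eq_add_of_le h
  rw [lamOrbit_add]
  exact le_lamOrbit_one c _ k

/-- Adjacency in the laminated configuration: one endpoint is the lamination step of the other. -/
theorem adj_lamConfig_iff (c : Set (Site 2)) (u v : Site 2) :
    (openGraph (lamConfig c)).Adj u v ↔ v = lamStep c u ∨ u = lamStep c v := by
  rw [openGraph, SimpleGraph.fromEdgeSet_adj]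
  simp only [lamConfig, Set.mem_setOf_eq]
  constructor
  · rintro ⟨⟨w, ⟨he, hw⟩ | ⟨he, hw⟩⟩, hne⟩
    · have hs : lamStep c w = w + ![1, 0] := by simp [lamStep, hw]
      rcases Sym2.eq_iff.1 he with ⟨rfl, rfl⟩ | ⟨rfl, rfl⟩
      · exact Or.inl hs.symm
      · exact Or.inr hs.symm
    · have hs : lamStep c w = w + ![0, 1] := by simp [lamStep, hw]
      rcases Sym2.eq_iff.1 he with ⟨rfl, rfl⟩ | ⟨rfl, rfl⟩
      · exact Or.inl hs.symm
      · exact Or.inr hs.symm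
  · rintro (h | h)
    · refine ⟨⟨u, ?_⟩, fun huv => lamStep_ne_self c u (h ▸ huv).symm⟩
      by_cases hu : u ∈ c
      · exact Or.inl ⟨by rw [h]; simp [lamStep, hu], hu⟩
      · exact Or.inr ⟨by rw [h]; simp [lamStep, hu], hu⟩
    · refine ⟨⟨v, ?_⟩, fun huv => lamStep_ne_self c v (h ▸ huv)⟩
      by_cases hv : v ∈ c
      · exact Or.inl ⟨by rw [h, Sym2.eq_swap]; simp [lamStep, hv], hv⟩
      · exact Or.inr ⟨by rw [h, Sym2.eq_swap]; simp [lamStep, hv], hv⟩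

/-- **Unimodality of simple paths in the laminated forest.** A simple path of the open graph of
`lamConfig c` (restricted to any vertex set `T`) first ASCENDS along the forward orbit of its start
and then DESCENDS along the (reversed) forward orbit of its end: there is `k ≤ length` with
`p_j = lamOrbit c u j` for `j ≤ k` and `p_j = lamOrbit c v (length - j)` for `k ≤ j ≤ length`.
(Every vertex has exactly one "upper" neighbour `lamStep c v`: a valley would revisit a vertex.) -/
theorem path_unimodal (c : Set (Site 2)) (T : Set (Site 2)) {u v : T}
    (p : ((openGraph (lamConfig c)).induce T).Walk u v) (hp : p.IsPath) :
    ∃ k, k ≤ p.length ∧ (∀ j, j ≤ k → (p.getVert j : Site 2) = lamOrbit c u j) ∧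
      (∀ j, k ≤ j → j ≤ p.length → (p.getVert j : Site 2) = lamOrbit c v (p.length - j)) := by
  induction p with
  | nil =>
    exact ⟨0, le_rfl, fun j hj => by simp [Nat.le_zero.1 hj], fun j _ hj => by
      simp [SimpleGraph.Walk.length_nil] at hj; simp [hj]⟩
  | @cons a b w hab q ih =>
    rw [SimpleGraph.Walk.cons_isPath_iff] at hp
    obtain ⟨k, hk, hasc, hdesc⟩ := ih hp.1
    have hab' : (openGraph (lamConfig c)).Adj (a : Site 2) b := hab
    rw [adj_lamConfig_iff] at hab'
    rcases hab' with hup | hdown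
    · -- step up: prepend to the ascending part
      refine ⟨k + 1, by simp; omega, fun j hj => ?_, fun j hj hjl => ?_⟩
      · rcases j with _ | j
        · simp
        · rw [SimpleGraph.Walk.getVert_cons_succ, hasc j (by omega), lamOrbit_succ', ← hup]
      · rcases j with _ | j
        · omega
        · rw [SimpleGraph.Walk.getVert_cons_succ, SimpleGraph.Walk.length_cons,
            hdesc j (by omega) (by simp at hjl; omega)]
          congr 1
          omega
    · -- step down: the rest must be entirely descending (else it would revisit `a`)
      have hk0 : k = 0 := by
        by_contra hk0
        have h1 := hasc 1 (by omega)
        simp only [lamOrbit_succ, lamOrbit_zero] at h1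
        have hmem : q.getVert 1 ∈ q.support := q.getVert_mem_support 1
        have heq : q.getVert 1 = a := Subtype.ext (by rw [h1, ← hdown])
        exact hp.2 (heq ▸ hmem)
      subst hk0
      refine ⟨0, by simp, fun j hj => by simp [Nat.le_zero.1 hj], fun j _ hjl => ?_⟩
      rcases j with _ | j
      · have h0 := hdesc 0 le_rfl (Nat.zero_le _)
        simp only [SimpleGraph.Walk.getVert_zero, Nat.sub_zero] at h0
        simp only [SimpleGraph.Walk.getVert_zero, SimpleGraph.Walk.length_cons, Nat.sub_zero,
          lamOrbit_succ, ← h0]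
        exact hdown
      · rw [SimpleGraph.Walk.getVert_cons_succ, SimpleGraph.Walk.length_cons,
          hdesc j (by omega) (by simp at hjl; omega)]
        congr 1
        omega

/-! ### From a laminated crossing to an orbit event -/

/-- `√2 < 3/2`. -/
theorem sqrt_two_lt' : Real.sqrt 2 < (3 / 2 : ℝ) := by
  rw [show (3 / 2 : ℝ) = Real.sqrt ((3/2)^2) by rw [Real.sqrt_sq (by norm_num)]]
  exact Real.sqrt_lt_sqrt (by norm_num) (by norm_num)

/-- In a laminated configuration, an open crossing between two sets inside `T` forces the forward
orbit of its left endpoint to stay in `T` up to a vertex `m` lying weakly north-east of the right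
endpoint (the peak of the unimodal path). -/
theorem lam_openCrossing_orbit (c : Set (Site 2)) {T A B : Set (Site 2)}
    (h : lamConfig c ∈ openCrossing T A B) :
    ∃ x ∈ A, ∃ y ∈ B, x ∈ T ∧ ∃ k : ℕ, lamOrbit c x k ∈ T ∧ y 0 ≤ lamOrbit c x k 0 := by
  classical
  obtain ⟨x, hxA, y, hyB, hxT, hyT, hreach⟩ := h
  obtain ⟨W⟩ := hreach
  set p := W.toPath with hp
  obtain ⟨k, hk, hasc, hdesc⟩ := path_unimodal c T p.1 p.2
  refine ⟨x, hxA, y, hyB, hxT, k, ?_, ?_⟩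
  · rw [← hasc k le_rfl]; exact (p.1.getVert k).2
  · rw [← hasc k le_rfl, hdesc k le_rfl hk]; exact le_lamOrbit_zero c y _

/-- The finite box containing every possible left endpoint of a horizontal crossing of
`w + [0, a] × [0, n]` on `√2 ℤ²`. -/
def startBox (w : ℂ) (n : ℕ) : Finset (Site 2) :=
  Finset.Icc ![⌊w.re / Real.sqrt 2⌋ - 1, ⌈w.im / Real.sqrt 2⌉]
    ![⌊w.re / Real.sqrt 2⌋, ⌈w.im / Real.sqrt 2⌉ + n]

/-- The start box has `2 (n + 1)` vertices. -/
theorem card_startBox (w : ℂ) (n : ℕ) : (startBox w n).card = 2 * (n + 1) := by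
  rw [startBox, Pi.card_Icc, Fin.prod_univ_two]
  simp only [Matrix.cons_val_zero, Matrix.cons_val_one, Int.card_Icc]
  have h1 : (⌊w.re / Real.sqrt 2⌋ + 1 - (⌊w.re / Real.sqrt 2⌋ - 1)).toNat = 2 := by
    rw [show ⌊w.re / Real.sqrt 2⌋ + 1 - (⌊w.re / Real.sqrt 2⌋ - 1) = 2 by ring]; rfl
  have h2 : (⌈w.im / Real.sqrt 2⌉ + ↑n + 1 - ⌈w.im / Real.sqrt 2⌉).toNat = n + 1 := by
    rw [show ⌈w.im / Real.sqrt 2⌉ + ↑n + 1 - ⌈w.im / Real.sqrt 2⌉ = (n + 1 : ℕ) by push_cast; ring]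
    exact Int.toNat_natCast _
  rw [h1, h2]

/-- Every admissible left endpoint of a horizontal crossing of `w + [0, a] × [0, n]` lies in the
start box (floor/ceiling bookkeeping on `√2 ℤ² - w`). -/
theorem mem_startBox {w : ℂ} {n : ℕ} {x : Site 2}
    (hre : (squareLatticeEmbedding.z x - w).re ∈ Set.Icc (-2 : ℝ) 0)
    (him : (squareLatticeEmbedding.z x - w).im ∈ Set.Icc (0 : ℝ) n) : x ∈ startBox w n := by
  have hr0 : (0 : ℝ) < Real.sqrt 2 := by positivity
  have hr1 := Real.one_lt_sqrt_two
  simp only [Complex.sub_re, Complex.sub_im, TrackExchange.zsq_re, TrackExchange.zsq_im,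
    Set.mem_Icc] at hre him
  set a := ⌊w.re / Real.sqrt 2⌋ with ha
  set b := ⌈w.im / Real.sqrt 2⌉ with hb
  have ha1 : (a : ℝ) ≤ w.re / Real.sqrt 2 := Int.floor_le _
  have ha2 : w.re / Real.sqrt 2 < a + 1 := Int.lt_floor_add_one _
  have hb1 : w.im / Real.sqrt 2 ≤ b := Int.le_ceil _
  have hb2 : (b : ℝ) - 1 < w.im / Real.sqrt 2 := by
    have := Int.ceil_lt_add_one (w.im / Real.sqrt 2); linarith
  rw [div_lt_iff₀ hr0] at ha2
  rw [le_div_iff₀ hr0] at ha1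
  rw [div_le_iff₀ hr0] at hb1
  rw [lt_div_iff₀ hr0] at hb2
  have hx0 : x 0 ≤ a := by
    have h : (x 0 : ℝ) < a + 1 := by nlinarith [hre.2]
    have h' : x 0 < a + 1 := by exact_mod_cast h
    omega
  have hx0' : a - 1 ≤ x 0 := by
    have : ((a : ℝ) - 2) < x 0 := by nlinarith [hre.1]
    have : a - 2 < x 0 := by exact_mod_cast this
    omega
  have hx1 : b ≤ x 1 := by
    have : ((b : ℝ) - 1) < x 1 := by nlinarith [him.1]
    have : b - 1 < x 1 := by exact_mod_cast this
    omega
  have hx1' : x 1 ≤ b + n := by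
    have : (x 1 : ℝ) ≤ b + n := by nlinarith [him.2]
    exact_mod_cast this
  simp only [startBox, Finset.mem_Icc, Pi.le_def, Fin.forall_fin_two, Matrix.cons_val_zero,
    Matrix.cons_val_one]
  exact ⟨⟨hx0', hx1⟩, hx0, hx1'⟩

/-- **Deterministic core of the lamination bound.** If the laminated configuration of `c` crosses
`w + [0, 8n] × [0, n]` horizontally (slack-2 event on `√2 ℤ²`), then some vertex `x` of the start
box has a forward orbit making at most `n` north steps among its first `5n` steps. -/
theorem lam_crossing_orbit (c : Set (Site 2)) (w : ℂ) (n : ℕ)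
    (h : lamConfig c ∈ embRectCrossing (fun v => squareLatticeEmbedding.z v - w) (8 * n) n) :
    ∃ x ∈ startBox w n, lamOrbit c x (5 * n) 1 ≤ x 1 + n := by
  obtain ⟨x, hxA, y, hyB, hxT, k, hmT, hym⟩ := lam_openCrossing_orbit c h
  simp only [Set.mem_setOf_eq] at hxA hyB hxT hmT
  refine ⟨x, mem_startBox ⟨hxT.1.1, hxA⟩ hxT.2, ?_⟩
  have hr1 := Real.one_lt_sqrt_two
  have hr2 := sqrt_two_lt'
  set m := lamOrbit c x k with hm
  simp only [Complex.sub_re, Complex.sub_im, TrackExchange.zsq_re, TrackExchange.zsq_im,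
    Set.mem_Icc] at hxA hyB hxT hmT
  have hsum := lamOrbit_sum c x k
  have hm0 := le_lamOrbit_zero c x k
  have hm1 := le_lamOrbit_one c x k
  rw [← hm] at hsum hm0 hm1
  have hym' : (y 0 : ℝ) ≤ m 0 := by exact_mod_cast hym
  -- east steps ≥ 5n
  have heast : 5 * (n : ℤ) ≤ m 0 - x 0 := by
    have h1 : (8 * n : ℝ) ≤ Real.sqrt 2 * (m 0 - x 0) := by nlinarith [hyB, hxA]
    have h2 : (0 : ℝ) ≤ m 0 - x 0 := by exact_mod_cast sub_nonneg.2 hm0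
    have h3 : (5 * n : ℝ) ≤ m 0 - x 0 := by nlinarith
    exact_mod_cast h3
  -- north steps ≤ n
  have hnorth : m 1 - x 1 ≤ (n : ℤ) := by
    have h1 : Real.sqrt 2 * (m 1 - x 1) ≤ n := by nlinarith [hmT.2.2, hxT.2.1]
    have h2 : (0 : ℝ) ≤ m 1 - x 1 := by exact_mod_cast sub_nonneg.2 hm1
    have h3 : (m 1 : ℝ) - x 1 ≤ n := by nlinarith
    exact_mod_cast h3
  have hk : 5 * n ≤ k := by
    have : (5 * n : ℤ) ≤ k := by linarith
    exact_mod_cast this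
  calc lamOrbit c x (5 * n) 1 ≤ m 1 := lamOrbit_one_mono c x hk
    _ ≤ x 1 + n := by linarith

/-! ### Cylinder probabilities of `prodBernoulli` along injective families (used in part 2) -/

open ProbabilityTheory in
/-- Cylinder probability along an injective family of coordinates. -/
theorem prodBernoulli_real_cylinder_of_injective {ι κ : Type*} [Fintype κ] (p : ι → unitInterval)
    {φ : κ → ι} (hφ : Function.Injective φ) (b : κ → Prop) :
    (prodBernoulli p).real {ω | ∀ j, φ j ∈ ω ↔ b j} =
      ∏ j, (Ber(True, False, p (φ j))).real {r | r ↔ b j} := by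
  classical
  have hex : ∀ j, (∃ j', φ j' = φ j ∧ b j') ↔ b j := fun j =>
    ⟨fun ⟨j', hj', hb'⟩ => hφ hj' ▸ hb', fun hb => ⟨j, rfl, hb⟩⟩
  have hpre : (fun q : ι → Prop => {i | q i}) ⁻¹' {ω : Set ι | ∀ j, φ j ∈ ω ↔ b j} =
      Set.pi (↑(Finset.univ.map ⟨φ, hφ⟩)) (fun i => {r | r ↔ ∃ j, φ j = i ∧ b j}) := by
    ext q
    simp only [Set.mem_preimage, Set.mem_setOf_eq, Set.mem_pi, Finset.coe_map,
      Function.Embedding.coeFn_mk, Finset.coe_univ, Set.image_univ, Set.mem_range]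
    constructor
    · rintro h i ⟨j, rfl⟩
      rw [hex]
      exact h j
    · intro h j
      have := h (φ j) ⟨j, rfl⟩
      rw [hex] at this
      exact this
  rw [prodBernoulli_real_eq_infinitePi, measureReal_def, hpre,
    Measure.infinitePi_pi _ (fun _ _ => MeasurableSet.of_discrete), ENNReal.toReal_prod,
    Finset.prod_map]
  refine Finset.prod_congr rfl fun j _ => ?_
  rw [measureReal_def]
  congr 2
  ext r
  simp only [Set.mem_setOf_eq, Function.Embedding.coeFn_mk, hex]

open ProbabilityTheory in
/-- A fair coin lands on either prescribed side with probability `1/2`. -/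
theorem ber_half_real_iff (b : Prop) : (Ber(True, False, half)).real {r | r ↔ b} = 1 / 2 := by
  by_cases hb : b
  · have : {r | r ↔ b} = {True} := by ext r; simp [hb]
    rw [this, measureReal_def, bernoulliMeasure_prop_apply_true, ENNReal.toReal_ofReal (by simp),
      coe_half]
  · have : {r | r ↔ b} = {False} := by ext r; simp [hb]
    rw [this, measureReal_def, bernoulliMeasure_prop_apply_false,
      ENNReal.toReal_ofReal (by rw [coe_half]; norm_num), coe_half]
    norm_num

end

end Summit.CriticalPhenomena.CardyFormulaZ2.Theorems.UniformBoxCrossing.Negative
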